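import Literature.Topology.FourManifolds.SuspendedFamilyFoldChart
import Literature.Analysis.Calculus.HadamardSndParam
import HarnessLib

/-!
# The critical section of a family of functions with nondegenerate fibre Hessian

Topic `Literature/Topology/FourManifolds` (towards fold charts at generic indefinite fold
points: the parametric Morse lemma with `k` fibre variables, generalising Step A of
`SuspendedFamilyFoldChart.lean`).  For a `C^∞` family `f : ℝ × ℝᵏ → ℝ` of functions of
`w ∈ ℝᵏ` parametrised by `t ∈ ℝ`, write `∇f (t, w) ∈ ℝᵏ` for the FIBRE gradient (the vector of
partial derivatives `∂f/∂wᵢ = Df (0, eᵢ)`).  If `∇f (t₀, w₀) = 0` and the fibre Hessian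
`(a, b) ↦ D²f(t₀, w₀) (0, a) (0, b)` is nondegenerate, then the fibrewise critical points near
`(t₀, w₀)` form the graph of a `C^∞` section `t ↦ ξ t` (inverse function theorem applied to
`(t, w) ↦ (t, ∇f (t, w))`) — the first step of the real normal form of a fold (Baykur–Saeki
2017, §2.1; Lekili 2009, §3) and of every Morse–Bott-type lemma (Hirsch 1976, Ch. 6 §1).
Everything is PROVED; no named fact.

* `fibreGrad f x`, `apply_inr_eq_sum` (`L (0, b) = Σᵢ bᵢ L (0, eᵢ)`), `fibreGrad_eq_zero_iff`,
  `contDiff_fibreGrad`, `hasFDerivAt_fibreGrad_apply`;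
* `exists_fibrewiseCriticalSection` — **the smooth critical section `ξ`**.

## References

* R. İ. Baykur, O. Saeki, *Simplifying indefinite fibrations on 4-manifolds*, arXiv:1705.11169
  (Trans. AMS 376, 2023), §2.1. [BaykurSaeki2017]
* M. W. Hirsch, *Differential Topology* (1976), Ch. 6 §1 (Morse lemma). [HirschDT1976]
-/

noncomputable section

open Set Function Filter
open scoped Topology ContDiff

namespace Literature.Topology.FourManifolds

/-- Local notation: `𝔼 n` is the model Euclidean space `EuclideanSpace ℝ (Fin n)`. -/
local notation "𝔼 " n:arg => EuclideanSpace ℝ (Fin n)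

variable {k : ℕ}

/-! ### Linear algebra on `ℝ × ℝᵏ` -/

/-- A vector `(0, b)` of `ℝ × ℝᵏ` expanded in the fibre basis: `(0, b) = Σᵢ bᵢ • (0, eᵢ)`.
[folklore] -/
theorem inr_eq_sum_smul_single (b : 𝔼 k) :
    (((0 : ℝ), b) : ℝ × 𝔼 k) =
      ∑ i : Fin k, b i • (((0 : ℝ), EuclideanSpace.single i (1 : ℝ)) : ℝ × 𝔼 k) := by
  have hb : b = ∑ i : Fin k, b i • EuclideanSpace.single i (1 : ℝ) := by
    conv_lhs => rw [← (EuclideanSpace.basisFun (Fin k) ℝ).sum_repr b]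
    simp
  refine Prod.ext ?_ ?_
  · simp [Prod.fst_sum]
  · rw [Prod.snd_sum]
    simpa using hb

/-- **Fibre-linear functionals are determined by the fibre basis**:
`L (0, b) = Σᵢ bᵢ L (0, eᵢ)` for a continuous linear `L` on `ℝ × ℝᵏ`. [folklore] -/
theorem apply_inr_eq_sum {F : Type*} [NormedAddCommGroup F] [NormedSpace ℝ F]
    (L : (ℝ × 𝔼 k) →L[ℝ] F) (b : 𝔼 k) :
    L ((0 : ℝ), b) = ∑ i : Fin k, b i • L ((0 : ℝ), EuclideanSpace.single i (1 : ℝ)) := by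
  rw [inr_eq_sum_smul_single b, map_sum]
  exact Finset.sum_congr rfl fun i _ => by rw [map_smul]

/-! ### The fibre gradient -/

/-- **The fibre gradient** of `f : ℝ × ℝᵏ → ℝ` at `x = (t, w)`: the vector of partial
derivatives `(∂f/∂wᵢ (x))ᵢ = (Df(x) (0, eᵢ))ᵢ`. [folklore] -/
def fibreGrad (f : ℝ × 𝔼 k → ℝ) (x : ℝ × 𝔼 k) : 𝔼 k :=
  WithLp.toLp 2 fun i => fderiv ℝ f x ((0 : ℝ), EuclideanSpace.single i (1 : ℝ))

/-- Components of the fibre gradient. [folklore] -/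
@[simp] theorem fibreGrad_apply (f : ℝ × 𝔼 k → ℝ) (x : ℝ × 𝔼 k) (i : Fin k) :
    fibreGrad f x i = fderiv ℝ f x ((0 : ℝ), EuclideanSpace.single i (1 : ℝ)) := rfl

/-- **The fibre gradient vanishes iff the fibre derivative does**: `∇f(x) = 0 ↔ Df(x) (0, ·) = 0`.
[folklore] -/
theorem fibreGrad_eq_zero_iff (f : ℝ × 𝔼 k → ℝ) (x : ℝ × 𝔼 k) :
    fibreGrad f x = 0 ↔ ∀ a : 𝔼 k, fderiv ℝ f x ((0 : ℝ), a) = 0 := by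
  constructor
  · intro h a
    rw [apply_inr_eq_sum]
    refine Finset.sum_eq_zero fun i _ => ?_
    have hi : fibreGrad f x i = 0 := by rw [h]; rfl
    rw [fibreGrad_apply] at hi
    rw [hi, smul_zero]
  · intro h
    ext i
    simpa using h (EuclideanSpace.single i (1 : ℝ))

/-- The fibre gradient of a `C^∞` family is `C^∞`. [folklore] -/
theorem contDiff_fibreGrad {f : ℝ × 𝔼 k → ℝ} (hf : ContDiff ℝ ∞ f) :
    ContDiff ℝ ∞ (fibreGrad f) := by
  rw [contDiff_euclidean]
  intro i
  simpa using (hf.fderiv_right le_rfl).clm_apply contDiff_const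

/-- **Derivative of a component of the fibre gradient**: `D(∂f/∂wᵢ)(x) v = D²f(x) v (0, eᵢ)`.
[folklore] -/
theorem hasFDerivAt_fibreGrad_apply {f : ℝ × 𝔼 k → ℝ} (hf : ContDiff ℝ ∞ f) (x : ℝ × 𝔼 k)
    (i : Fin k) :
    HasFDerivAt (fun x => fibreGrad f x i)
      ((fderiv ℝ (fderiv ℝ f) x).flip ((0 : ℝ), EuclideanSpace.single i (1 : ℝ))) x := by
  have hD2 : HasFDerivAt (fderiv ℝ f) (fderiv ℝ (fderiv ℝ f) x) x :=
    (((hf.fderiv_right (m := ∞) le_rfl).differentiable (by simp)) x).hasFDerivAt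
  have h := hD2.clm_apply (hasFDerivAt_const (((0 : ℝ), EuclideanSpace.single i (1 : ℝ)) :
    ℝ × 𝔼 k) x)
  simp only [fibreGrad_apply]
  refine h.congr_fderiv (ContinuousLinearMap.ext fun v => ?_)
  simp

/-! ### The critical section -/

/-- **The critical section of a family with nondegenerate fibre Hessian** (inverse function
theorem).  Let `f : ℝ × ℝᵏ → ℝ` be `C^∞`, `∇f (t₀, w₀) = 0`, and let the fibre Hessian
`(a, b) ↦ D²f (t₀, w₀) (0, a) (0, b)` be nondegenerate.  Then on an open interval `U ∋ t₀` there
is a `C^∞` map `ξ : U → ℝᵏ` with `ξ t₀ = w₀` and `∇f (t, ξ t) = 0`: near `(t₀, w₀)` the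
fibrewise critical points of the family are the graph of `ξ` (as `(t, w) ↦ (t, ∇f (t, w))` is a
local diffeomorphism: its derivative `(τ, a) ↦ (τ, ∂ₜ∇f τ + Hess a)` is injective).
[cite: HirschDT1976, Ch. 6 §1] -/
theorem exists_fibrewiseCriticalSection {f : ℝ × 𝔼 k → ℝ} (hf : ContDiff ℝ ∞ f) {t₀ : ℝ}
    {w₀ : 𝔼 k} (hcrit : fibreGrad f (t₀, w₀) = 0)
    (hH : ∀ a : 𝔼 k, (∀ b : 𝔼 k,
      fderiv ℝ (fderiv ℝ f) (t₀, w₀) ((0 : ℝ), a) ((0 : ℝ), b) = 0) → a = 0) :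
    ∃ U : Set ℝ, IsOpen U ∧ t₀ ∈ U ∧ ∃ ξ : ℝ → 𝔼 k, ContDiffOn ℝ ∞ ξ U ∧ ξ t₀ = w₀ ∧
      ∀ t ∈ U, fibreGrad f (t, ξ t) = 0 := by
  have hG : ContDiff ℝ ∞ (fibreGrad f) := contDiff_fibreGrad hf
  -- `Θ (t, w) = (t, ∇f (t, w))` and its derivative at `(t₀, w₀)`
  set Θ : ℝ × 𝔼 k → ℝ × 𝔼 k := fun p => (p.1, fibreGrad f p) with hΘ_def
  have hΘs : ContDiff ℝ ∞ Θ := contDiff_fst.prodMk hG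
  have hGd : HasFDerivAt (fibreGrad f) (fderiv ℝ (fibreGrad f) (t₀, w₀)) (t₀, w₀) :=
    ((hG.differentiable (by simp)) _).hasFDerivAt
  set Θ' : (ℝ × 𝔼 k) →L[ℝ] ℝ × 𝔼 k :=
    (ContinuousLinearMap.fst ℝ ℝ (𝔼 k)).prod (fderiv ℝ (fibreGrad f) (t₀, w₀)) with hΘ'
  have hΘd : HasFDerivAt Θ Θ' (t₀, w₀) := hasFDerivAt_fst.prodMk hGd
  -- components of `D(∇f)(t₀, w₀) v`: `D²f (t₀, w₀) v (0, eᵢ)`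
  have hcomp : ∀ (v : ℝ × 𝔼 k) (i : Fin k), fderiv ℝ (fibreGrad f) (t₀, w₀) v i =
      fderiv ℝ (fderiv ℝ f) (t₀, w₀) v ((0 : ℝ), EuclideanSpace.single i (1 : ℝ)) := by
    intro v i
    have h1 : fderiv ℝ (fun x => fibreGrad f x i) (t₀, w₀) =
        (EuclideanSpace.proj i : 𝔼 k →L[ℝ] ℝ).comp (fderiv ℝ (fibreGrad f) (t₀, w₀)) :=
      ((EuclideanSpace.proj i : 𝔼 k →L[ℝ] ℝ).hasFDerivAt.comp _ hGd).fderiv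
    have h2 := (hasFDerivAt_fibreGrad_apply hf (t₀, w₀) i).fderiv
    have h3 := congrArg (fun L : (ℝ × 𝔼 k) →L[ℝ] ℝ => L v) (h1.symm.trans h2)
    simpa using h3
  -- `Θ'` is injective
  have hinj : Injective Θ' := by
    refine (injective_iff_map_eq_zero Θ').2 fun v hv => ?_
    obtain ⟨τ, a⟩ := v
    have h1 : τ = 0 := by simpa [hΘ'] using congrArg Prod.fst hv
    subst h1
    have h2 : fderiv ℝ (fibreGrad f) (t₀, w₀) ((0 : ℝ), a) = 0 := by
      simpa [hΘ'] using congrArg Prod.snd hv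
    have ha : a = 0 := by
      refine hH a fun b => ?_
      rw [apply_inr_eq_sum (fderiv ℝ (fderiv ℝ f) (t₀, w₀) ((0 : ℝ), a)) b]
      refine Finset.sum_eq_zero fun i _ => ?_
      rw [← hcomp ((0 : ℝ), a) i, h2]
      simp
    rw [ha]
    rfl
  obtain ⟨T, hT⟩ := exists_continuousLinearEquiv_coe_eq hinj
  obtain ⟨G₁, hG₁Θ, hmem, -, -, hG₁s'⟩ :=
    exists_openPartialHomeomorph_contDiffOn_symm isOpen_univ (mem_univ (t₀, w₀)) (m := ∞)
      (by simp) hΘs.contDiffOn T (by rw [hT]; exact hΘd)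
  -- the interval `U` and the section `ξ`
  have hΘ₀ : G₁ (t₀, w₀) = (t₀, 0) := by
    rw [hG₁Θ]
    simp [hΘ_def, hcrit]
  have htarget : ((t₀, (0 : 𝔼 k)) : ℝ × 𝔼 k) ∈ G₁.target := hΘ₀ ▸ G₁.map_source hmem
  refine ⟨{t | ((t, (0 : 𝔼 k)) : ℝ × 𝔼 k) ∈ G₁.target},
    G₁.open_target.preimage (continuous_id.prodMk continuous_const), htarget,
    fun t => (G₁.symm (t, 0)).2, ?_, ?_, ?_⟩
  · have hc : ContDiffOn ℝ ∞ (fun t : ℝ => ((t, (0 : 𝔼 k)) : ℝ × 𝔼 k))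
        {t | ((t, (0 : 𝔼 k)) : ℝ × 𝔼 k) ∈ G₁.target} :=
      (contDiff_id.prodMk contDiff_const).contDiffOn
    exact (hG₁s'.comp hc fun t ht => ht).snd
  · show (G₁.symm (t₀, 0)).2 = w₀
    rw [← hΘ₀, G₁.left_inv hmem]
  · intro t ht
    have h1 : G₁ (G₁.symm (t, 0)) = (t, 0) := G₁.right_inv ht
    rw [hG₁Θ] at h1
    have h1a : (G₁.symm (t, 0)).1 = t := congrArg Prod.fst h1
    have h1b : fibreGrad f (G₁.symm (t, 0)) = 0 := congrArg Prod.snd h1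
    rw [show ((t, (G₁.symm (t, 0)).2) : ℝ × 𝔼 k) = G₁.symm (t, 0) from Prod.ext h1a.symm rfl]
    exact h1b

end Literature.Topology.FourManifolds

end
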